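import Summits.BirchSwinnertonDyer.BirchSwinnertonDyer.Theorems.AdditiveBranchIMCTwistRootNumberTwistedClass
import HarnessLib

/-!
# The E3′ class clause in geometric form — ARITHMETIC version (twist parameter `D = ℓ₀*·m`, no field) (LEAD g15)

Theorems only (no definition, no named fact, no `sorry`). `TwistRootNumberTwisted.quadraticTwist_discr_nonsplit_at_of_nonsplitClass` (p797470)
read for an arbitrary parameter `D = ℓ₀*·m` (`ℓ₀ ∤ m`) instead of a field discriminant: if `(m/ℓ₀) = −1` or `+1` according as
`W₁ = E^{(ℓ₀*)}` is split or not at `ℓ₀`, then a globally minimal model of `E^{(D)} = W₁^{(m)}` is multiplicative NON-split at `ℓ₀`. Needed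
for the AUXILIARY twist `E'' = E^{(ℓ₀*·a*)}` of the rank-zero field supply on the twisted road (the Dirichlet prime `a` is chosen in the class
`(a*/ℓ₀) = ∓1`), whose root number the positive-parameter engine `rootNumber_quadraticTwist_eq_of_potMult_nonsplit_pos` then reads.

* `quadraticTwist_nonsplit_at_of_class`.

BSD is proved for no curve by any of this.
References: [SilvermanAEC2009] VII.5 Prop. 5.1, X.5 Cor. 5.4, Ex. 10.16.
-/

set_option linter.dupNamespace false
set_option autoImplicit false

noncomputable section

open scoped Classical

open Literature.NumberTheory.EllipticCurves Literature.NumberTheory.EllipticCurves.ModularForms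
  IsDedekindDomain IsDedekindDomain.HeightOneSpectrum NumberField Rat.HeightOneSpectrum WeierstrassCurve
  Literature.NumberTheory.QuadraticFields Literature.NumberTheory.EllipticCurves.Rank1Residual
  Summit.BirchSwinnertonDyer.Rank1Residual
  Summit.BirchSwinnertonDyer.BirchSwinnertonDyer.Theorems

namespace Summit.BirchSwinnertonDyer.BirchSwinnertonDyer.Theorems.TwistRootNumberTwisted

variable (W : WeierstrassCurve ℚ) [W.IsElliptic]

/-- **The E3′ class clause in geometric form — arithmetic version (no field).** For an odd prime `ℓ₀` at which `W₁ = E^{(ℓ₀*)}` is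
multiplicative and `D = ℓ₀*·m` with `ℓ₀ ∤ m` and `(m/ℓ₀) = −1` or `+1` according as `W₁` is split or not at `ℓ₀`, every globally
minimal model `Wd` of `E^{(D)}` is multiplicative and NOT split at `ℓ₀` (unit-twist split law, Silverman *AEC* Ex. 10.16;
`quadraticTwist_discr_nonsplit_at_of_nonsplitClass` is the case `D = d_K`). [cite: SilvermanAEC2009, VII.5 Prop. 5.1(b), X.5 Cor. 5.4 and Ex. 10.16] -/
theorem quadraticTwist_nonsplit_at_of_class {ℓ₀ : ℕ} [hℓ₀ : Fact ℓ₀.Prime] (hℓ₀2 : ℓ₀ ≠ 2)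
    (hmult₀ : (W.quadraticTwist (((-1 : ℤ) ^ (ℓ₀ / 2) * ℓ₀ : ℤ) : ℚ)).HasMultiplicativeReductionAtPrime ℓ₀)
    {D m : ℤ} (hDm : D = (-1 : ℤ) ^ (ℓ₀ / 2) * ℓ₀ * m) (hℓ₀m : ¬ (ℓ₀ : ℤ) ∣ m)
    (hclass : legendreSym ℓ₀ m =
      (if (W.quadraticTwist (((-1 : ℤ) ^ (ℓ₀ / 2) * ℓ₀ : ℤ) : ℚ)).HasSplitMultiplicativeReductionAtPrime ℓ₀ then -1 else 1))
    (Wd : WeierstrassCurve ℚ) [Wd.IsElliptic] [Wd.IsGloballyMinimal]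
    (hWd : ∃ C : VariableChange ℚ, C • W.quadraticTwist (D : ℚ) = Wd) :
    Wd.HasMultiplicativeReductionAtPrime ℓ₀ ∧ ¬ Wd.HasSplitMultiplicativeReductionAtPrime ℓ₀ := by
  -- the place of `𝓞 ℚ` over `ℓ₀`
  obtain ⟨w, hw⟩ : ∃ w : HeightOneSpectrum (𝓞 ℚ), (primesEquiv w : ℕ) = ℓ₀ :=
    ⟨(primesEquiv (R := 𝓞 ℚ)).symm ⟨ℓ₀, hℓ₀.out⟩, by simp⟩
  set s : ℤ := (-1 : ℤ) ^ (ℓ₀ / 2) * ℓ₀ with hs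
  have hs0 : s ≠ 0 := mul_ne_zero (pow_ne_zero _ (by norm_num)) (by exact_mod_cast hℓ₀.out.ne_zero)
  have hm0 : m ≠ 0 := by rintro h; exact hℓ₀m (by rw [h]; exact dvd_zero _)
  have hmQ : (m : ℚ) ≠ 0 := by exact_mod_cast hm0
  have hD0 : D ≠ 0 := by rw [hDm]; exact mul_ne_zero hs0 hm0
  have hDQ : (D : ℚ) ≠ 0 := by exact_mod_cast hD0
  -- the curves
  set W₁ := W.quadraticTwist ((s : ℤ) : ℚ) with hW₁
  haveI : W₁.IsElliptic := W.isElliptic_quadraticTwist (show ((s : ℤ) : ℚ) ≠ 0 by exact_mod_cast hs0)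
  haveI : (W.quadraticTwist (D : ℚ)).IsElliptic := W.isElliptic_quadraticTwist hDQ
  have hW'W₁ : W₁.quadraticTwist (m : ℚ) = W.quadraticTwist (D : ℚ) := by
    rw [hW₁, quadraticTwist_quadraticTwist, hDm]; push_cast; ring
  obtain ⟨Cd, hCd⟩ := hWd
  -- `Wd` is multiplicative at `ℓ₀` (unit twist of `W₁`)
  set vℤ : HeightOneSpectrum ℤ := (primesEquiv (R := ℤ)).symm ⟨ℓ₀, hℓ₀.out⟩ with hvℤ
  have hmultW₁ : W₁.HasMultiplicativeReductionAt vℤ :=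
    (W₁.hasMultiplicativeReductionAtPrime_iff_hasMultiplicativeReductionAt_holds ⟨ℓ₀, hℓ₀.out⟩).mp hmult₀
  have hmult' : (W₁.quadraticTwist (m : ℚ)).HasMultiplicativeReductionAt vℤ :=
    ((W₁.hasReductionAt_quadraticTwist_iff_of_not_dvd vℤ
      (by rw [hvℤ, Literature.NumberTheory.EllipticCurves.Rat.natGenerator_primesEquiv_symm]; exact hℓ₀2) (d := m)
      (by rw [hvℤ, Literature.NumberTheory.EllipticCurves.Rat.natGenerator_primesEquiv_symm]; exact hℓ₀m)).2.1).mpr hmultW₁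
  haveI : (W₁.quadraticTwist (m : ℚ)).IsElliptic := W₁.isElliptic_quadraticTwist hmQ
  have hmultD : (W.quadraticTwist (D : ℚ)).HasMultiplicativeReductionAtPrime ℓ₀ := by
    rw [← hW'W₁]
    exact ((W₁.quadraticTwist (m : ℚ)).hasMultiplicativeReductionAtPrime_iff_hasMultiplicativeReductionAt_holds
      ⟨ℓ₀, hℓ₀.out⟩).mpr hmult'
  have hmultWd : Wd.HasMultiplicativeReductionAtPrime ℓ₀ := by
    rw [← hCd, hasMultiplicativeReductionAtPrime_smul_iff]; exact hmultD
  refine ⟨hmultWd, ?_⟩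
  -- `Wd^{(m)} ≅ W₁`: `(Cd • E^{(D)})^{(m)} = C₁ • E^{(s·m·m)} = C₁ • C₂ • W₁`
  obtain ⟨C₂, hC₂⟩ := W₁.exists_variableChange_smul_eq_quadraticTwist_sq (θ := (m : ℚ)) hmQ
  have hWdm : Wd.quadraticTwist (m : ℚ) =
      ((⟨Cd.u, (m : ℚ) * Cd.r, 0, 0⟩ : VariableChange ℚ) * C₂) • W₁ := by
    rw [← hCd, WeierstrassCurve.quadraticTwist_smul, mul_smul, hC₂, hW₁, quadraticTwist_quadraticTwist,
      quadraticTwist_quadraticTwist, hDm]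
    push_cast
    ring_nf
  have hsplit_m : (Wd.quadraticTwist (m : ℚ)).HasSplitMultiplicativeReductionAtPrime ℓ₀ ↔
      W₁.HasSplitMultiplicativeReductionAtPrime ℓ₀ := by
    rw [hWdm, hasSplitMultiplicativeReductionAtPrime_smul_iff]
  -- the unit-twist law at the place `w` over `ℓ₀`, for the globally minimal `Wd`
  have hmultWd_w : Wd.HasMultiplicativeReductionAt w := (hasMultiplicativeReductionAtPrime_primesEquiv_iff_holds Wd w ℓ₀ hw).mp hmultWd
  have hw2 : (primesEquiv w : ℕ) ≠ 2 := by rw [hw]; exact hℓ₀2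
  have hwm : ¬ ((primesEquiv w : ℕ) : ℤ) ∣ m := by rw [hw]; exact hℓ₀m
  obtain ⟨-, -, key⟩ :=
    AdditivePotMult.hasMultiplicativeReductionAt_and_split_iff_quadraticTwist_of_not_dvd Wd w hw2 hwm hmultWd_w
  -- translate the place statements into `AtPrime` statements at `ℓ₀`
  haveI : (Wd.quadraticTwist (m : ℚ)).IsElliptic := Wd.isElliptic_quadraticTwist hmQ
  have e1 : (Wd.quadraticTwist (m : ℚ)).HasSplitMultiplicativeReductionAt w ↔
      (Wd.quadraticTwist (m : ℚ)).HasSplitMultiplicativeReductionAtPrime ℓ₀ := by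
    rw [← (Wd.quadraticTwist (m : ℚ)).hasSplitMultiplicativeReductionAtPrime_iff_hasSplitMultiplicativeReductionAt w]
    subst hw
    rfl
  have e2 : Wd.HasSplitMultiplicativeReductionAt w ↔ Wd.HasSplitMultiplicativeReductionAtPrime ℓ₀ := by
    rw [← Wd.hasSplitMultiplicativeReductionAtPrime_iff_hasSplitMultiplicativeReductionAt w]
    subst hw
    rfl
  have e3 : IsSquare ((m : ℤ) : ZMod (primesEquiv w : ℕ)) ↔ IsSquare ((m : ℤ) : ZMod ℓ₀) := by subst hw; rfl
  rw [e1, hsplit_m, e3, e2] at key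
  -- `key : W₁ split ↔ (m̄ square ↔ Wd split)`; the class clause says `m̄ square ↔ ¬ W₁ split`
  have hm_ne : ((m : ℤ) : ZMod ℓ₀) ≠ 0 := fun h ↦ hℓ₀m ((ZMod.intCast_zmod_eq_zero_iff_dvd m ℓ₀).mp h)
  have hclass' : legendreSym ℓ₀ m = (if W₁.HasSplitMultiplicativeReductionAtPrime ℓ₀ then -1 else 1) := hclass
  by_cases hs₁ : W₁.HasSplitMultiplicativeReductionAtPrime ℓ₀
  · -- case B: `(m/ℓ₀) = −1`, `m̄` not a square; `W₁` split forces `m̄ square ↔ Wd split`, so `Wd` is not split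
    rw [if_pos hs₁] at hclass'
    have hnsq : ¬ IsSquare ((m : ℤ) : ZMod ℓ₀) := (legendreSym.eq_neg_one_iff ℓ₀).mp hclass'
    intro hWd
    exact hnsq ((key.mp hs₁).mpr hWd)
  · -- case A: `(m/ℓ₀) = +1`, `m̄` a square; `W₁` not split forces `¬ (m̄ square ↔ Wd split)`, so `Wd` is not split
    rw [if_neg hs₁] at hclass'
    have hsq : IsSquare ((m : ℤ) : ZMod ℓ₀) := (legendreSym.eq_one_iff ℓ₀ hm_ne).mp hclass'
    intro hWd
    exact hs₁ (key.mpr (iff_of_true hsq hWd))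


end Summit.BirchSwinnertonDyer.BirchSwinnertonDyer.Theorems.TwistRootNumberTwisted

end
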